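import Literature.MathematicalPhysics.QuantumLattice.FlowLiebRobinsonProofs
import Literature.MathematicalPhysics.QuantumLattice.QuasiLocalAverageProofs
import Literature.MathematicalPhysics.QuantumLattice.QuasiLocalPiecesProofs
import HarnessLib

/-!
# The flow displacement formula and commutators of centred observables with quasi-local generators

Twenty-third file of the formalisation of the Michalakis–Zwolak stability theorem (hubbard.S19):
the ingredients of the estimate of `X²_u = U†(s) 𝓕_s(Q_u) U(s) − 𝓕_s(Q_u)` in MZ13 §5.2
(arXiv:1109.1588 p. 11: "a strength `J` perturbation … using Lemma 2 and properties of the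
unitary `U(s)`"), in the quasi-locality calculus of this formalisation (an observable `A` is
*centred* along a chain of regions `S k` with tails `E` when `‖A − 𝔼_{(S k)ᶜ}(A)‖ ≤ E k`):

* `conj_flow_sub_eq_integral`, `norm_conj_flow_sub_le_integral` — for the unitary propagator
  `U' = iD(s)U`: `U(t)ᴴ A U(t) − A = ∫₀ᵗ U(σ)ᴴ (A (iDσ) − (iDσ) A) U(σ) dσ` (fundamental theorem of
  calculus for `hasDerivWithinAt_conj_flow`) and `‖α_t(A) − A‖ ≤ ∫₀ᵗ ‖[A, D(σ)]‖ dσ`;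
* `twirl_eq_self_of_isSupportedOn` — strictly local observables are fixed by the twirl (rule R1);
* `norm_comm_local_interaction_le` — `‖[T, Σ_Z Ψ Z]‖ ≤ 2‖T‖ |B| J₀` for `T ∈ 𝔄_B` and an
  interaction of local norm `≤ J₀`; `norm_comm_centred_interaction_le` (R5, norm) — for a centred
  `A`: `‖[A, Σ_Z Ψ Z]‖ ≤ 2J₀ (‖A‖ |S 0| + Σ_k (E(k+1) + E k) |S(k+1)|)` (telescoping into strictly
  local shells, `eq_twirl_add_sum_range_sub`);
* `norm_comm_centred_sub_twirl_le` (R5, tails) — the commutator is again centred: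
  `‖[A, ΣΨ] − 𝔼_{Tᶜ}[A, ΣΨ]‖ ≤ 2 (2J₀ Σ_{m≤k<M} (E(k+1)+E k)|S(k+1)| + 2‖A‖ |S m| K)` when the
  short-range terms meeting `S m` lie in `T` and the long-range terms have local norm `≤ K`.

No definitions, no named facts (theorems only). [folklore]
-/

noncomputable section

open Matrix Complex Set Filter MeasureTheory Topology Finset
open scoped Matrix Matrix.Norms.L2Operator

namespace Literature.MathematicalPhysics.QuantumLattice

section Displacement

variable {n : Type*} [Fintype n] [DecidableEq n]

/-- **The flow displacement formula.** For the unitary propagator `U' = (iD(s)) U` on `[0, T]`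
(`D` continuous on the interval) and any `A`:
`U(t)ᴴ A U(t) − A = ∫₀ᵗ U(σ)ᴴ (A (iD σ) − (iD σ) A) U(σ) dσ` (fundamental theorem of calculus for
`hasDerivWithinAt_conj_flow`). MZ13 §5.2 (the terms `X²_u = U†𝓕(Q_u)U − 𝓕(Q_u)`),
BMNS 2011 §4. [folklore] -/
theorem conj_flow_sub_eq_integral {D : ℝ → Matrix n n ℂ} {T : ℝ} (hDc : ContinuousOn D (Icc 0 T))
    (hDh : ∀ s ∈ Icc 0 T, (D s).IsHermitian) {U : ℝ → Matrix n n ℂ} (hU0 : U 0 = 1)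
    (hU : ∀ s ∈ Icc 0 T, HasDerivWithinAt U (((I : ℂ) • D s) * U s) (Icc 0 T) s)
    (A : Matrix n n ℂ) {t : ℝ} (ht : t ∈ Icc 0 T) :
    (U t)ᴴ * A * U t - A = ∫ σ in (0 : ℝ)..t,
      (U σ)ᴴ * (A * ((I : ℂ) • D σ) - ((I : ℂ) • D σ) * A) * U σ := by
  have hderiv : ∀ s ∈ Icc 0 T, HasDerivWithinAt (fun u => (U u)ᴴ * A * U u)
      ((U s)ᴴ * (A * ((I : ℂ) • D s) - ((I : ℂ) • D s) * A) * U s) (Icc 0 T) s := fun s hs =>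
    hasDerivWithinAt_conj_flow (hU s hs) (conjTranspose_I_smul_of_isHermitian (hDh s hs)) A
  have hUc : ContinuousOn U (Icc 0 T) := fun s hs => (hU s hs).continuousWithinAt
  have hUHc : ContinuousOn (fun s => (U s)ᴴ) (Icc 0 T) := fun s hs =>
    (hasDerivWithinAt_conjTranspose (hU s hs)).continuousWithinAt
  have hgc : ContinuousOn (fun u => (U u)ᴴ * A * U u) (Icc 0 T) := fun s hs => (hderiv s hs).continuousWithinAt
  have hg'c : ContinuousOn (fun s => (U s)ᴴ * (A * ((I : ℂ) • D s) - ((I : ℂ) • D s) * A) * U s)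
      (Icc 0 T) :=
    (hUHc.mul ((continuousOn_const.mul (hDc.const_smul (I : ℂ))).sub
      ((hDc.const_smul (I : ℂ)).mul continuousOn_const))).mul hUc
  have ht0 : (0 : ℝ) ≤ t := ht.1
  have hsub : Icc 0 t ⊆ Icc 0 T := Icc_subset_Icc le_rfl ht.2
  have hFTC := intervalIntegral.integral_eq_sub_of_hasDeriv_right_of_le ht0 (hgc.mono hsub)
    (fun s hs => ?_) ((hg'c.mono (by rw [uIcc_of_le ht0]; exact hsub)).intervalIntegrable)
  · rw [hFTC]
    simp [hU0]
  · have hs' : s ∈ Icc 0 T := ⟨hs.1.le, hs.2.le.trans ht.2⟩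
    have hmem : Icc 0 T ∈ 𝓝[Ioi s] s :=
      mem_of_superset (Icc_mem_nhdsGT (lt_of_lt_of_le hs.2 ht.2)) (Icc_subset_Icc hs.1.le le_rfl)
    exact (hderiv s hs').mono_of_mem_nhdsWithin hmem

/-- **Norm of the flow displacement**: `‖α_t(A) − A‖ ≤ ∫₀ᵗ ‖A D(σ) − D(σ) A‖ dσ`. [folklore] -/
theorem norm_conj_flow_sub_le_integral {D : ℝ → Matrix n n ℂ} {T : ℝ} (hDc : ContinuousOn D (Icc 0 T))
    (hDh : ∀ s ∈ Icc 0 T, (D s).IsHermitian) {U : ℝ → Matrix n n ℂ} (hU0 : U 0 = 1)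
    (hU : ∀ s ∈ Icc 0 T, HasDerivWithinAt U (((I : ℂ) • D s) * U s) (Icc 0 T) s)
    (hU1 : ∀ s ∈ Icc 0 T, (U s)ᴴ * U s = 1) (hU2 : ∀ s ∈ Icc 0 T, U s * (U s)ᴴ = 1)
    (A : Matrix n n ℂ) {t : ℝ} (ht : t ∈ Icc 0 T) :
    ‖(U t)ᴴ * A * U t - A‖ ≤ ∫ σ in (0 : ℝ)..t, ‖A * D σ - D σ * A‖ := by
  rw [conj_flow_sub_eq_integral hDc hDh hU0 hU A ht]
  have ht0 : (0 : ℝ) ≤ t := ht.1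
  refine (intervalIntegral.norm_integral_le_integral_norm ht0).trans ?_
  refine intervalIntegral.integral_mono_on ht0 ?_ ?_ fun σ hσ => ?_
  · have hUc : ContinuousOn U (Icc 0 T) := fun s hs => (hU s hs).continuousWithinAt
    have hUHc : ContinuousOn (fun s => (U s)ᴴ) (Icc 0 T) := fun s hs =>
      (hasDerivWithinAt_conjTranspose (hU s hs)).continuousWithinAt
    have hg'c : ContinuousOn (fun s => (U s)ᴴ * (A * ((I : ℂ) • D s) - ((I : ℂ) • D s) * A) * U s)
        (Icc 0 T) :=
      (hUHc.mul ((continuousOn_const.mul (hDc.const_smul (I : ℂ))).sub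
        ((hDc.const_smul (I : ℂ)).mul continuousOn_const))).mul hUc
    exact (hg'c.norm.mono (by rw [uIcc_of_le ht0]; exact Icc_subset_Icc le_rfl ht.2)).intervalIntegrable
  · have hc : ContinuousOn (fun s => A * D s - D s * A) (Icc 0 T) :=
      (continuousOn_const.mul hDc).sub (hDc.mul continuousOn_const)
    exact (hc.norm.mono (by rw [uIcc_of_le ht0]; exact Icc_subset_Icc le_rfl ht.2)).intervalIntegrable
  · have hσ' : σ ∈ Icc 0 T := ⟨hσ.1, hσ.2.trans ht.2⟩
    have hUu : U σ ∈ unitary (Matrix n n ℂ) := Unitary.mem_iff.2 ⟨hU1 σ hσ', hU2 σ hσ'⟩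
    have hUu' : (U σ)ᴴ ∈ unitary (Matrix n n ℂ) := by
      rw [← star_eq_conjTranspose]; exact Unitary.star_mem hUu
    rw [norm_unitary_mul_mul_unitary hUu' hUu]
    have : A * ((I : ℂ) • D σ) - ((I : ℂ) • D σ) * A = (I : ℂ) • (A * D σ - D σ * A) := by
      rw [Matrix.mul_smul, Matrix.smul_mul, smul_sub]
    rw [this, norm_smul, Complex.norm_I, one_mul]

end Displacement

/-! ### Strictly local observables are fixed by the twirl (rule R1) -/

section Centred

variable {Λ' : Type*} [Fintype Λ'] [DecidableEq Λ'] {q : ℕ}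

/-- **Strictly local observables are fixed by the twirl off their support**:
`𝔼_S(O) = O` for `O ∈ 𝔄_{Sᶜ}` (rule R1 of the quasi-locality calculus). [folklore] -/
theorem twirl_eq_self_of_isSupportedOn (S : Finset Λ') {O : Op Λ' q} (hO : IsSupportedOn O Sᶜ) :
    twirl S O = O := by
  have h : ‖O - twirl S O‖ ≤ 0 := by
    refine norm_sub_twirl_le S O fun U hU _ => ?_
    rw [(commute_of_disjoint_holds hO hU disjoint_compl_left).eq, sub_self, norm_zero]
  have h0 : O - twirl S O = 0 := norm_le_zero_iff.mp h
  exact (sub_eq_zero.mp h0).symm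

/-- Variant: `𝔼_{Tᶜ}(O) = O` for `O` supported inside `T`. [folklore] -/
theorem twirl_compl_eq_self_of_isSupportedOn {T T' : Finset Λ'} (h : T' ⊆ T) {O : Op Λ' q}
    (hO : IsSupportedOn O T') : twirl Tᶜ O = O :=
  twirl_eq_self_of_isSupportedOn Tᶜ (by rw [compl_compl]; exact IsSupportedOn.mono_holds hO h)

/-- Conjugation is linear: `Uᴴ (A − B) U = Uᴴ A U − Uᴴ B U`. [folklore] -/
theorem conj_sub (U A B : Op Λ' q) : Uᴴ * (A - B) * U = Uᴴ * A * U - Uᴴ * B * U := by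
  rw [Matrix.mul_sub, Matrix.sub_mul]

end Centred

/-! ### R5: commutator of a centred observable with a quasi-local generator -/

section CommutatorCentred

variable {Λ : Type*} [Fintype Λ] [DecidableEq Λ] {q : ℕ}

/-- Commutator of a strictly local observable with an interaction of local norm `≤ J₀`:
`‖[T, Σ_Z Ψ Z]‖ ≤ 2‖T‖ |B| J₀` for `T ∈ 𝔄_B` (only the terms meeting `B` contribute). [folklore] -/
theorem norm_comm_local_interaction_le {Ψ : Interaction Λ q} (hΨ : Ψ.IsLocal) {J₀ : ℝ}
    (hJ : ∀ y : Λ, ∑ Z ∈ univ.filter (fun Z : Finset Λ => y ∈ Z), ‖Ψ Z‖ ≤ J₀)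
    {T : Op Λ q} {B : Finset Λ} (hT : IsSupportedOn T B) :
    ‖T * (∑ Z, Ψ Z) - (∑ Z, Ψ Z) * T‖ ≤ 2 * ‖T‖ * (#B * J₀) := by
  -- remove the terms disjoint from `B`
  have hsplit : T * (∑ Z, Ψ Z) - (∑ Z, Ψ Z) * T =
      T * (∑ Z ∈ univ.filter (fun Z : Finset Λ => ¬ Disjoint Z B), Ψ Z) -
        (∑ Z ∈ univ.filter (fun Z : Finset Λ => ¬ Disjoint Z B), Ψ Z) * T := by
    have hc := hΨ.commute_sum_filter_disjoint hT
    have hdec : (∑ Z, Ψ Z) = (∑ Z ∈ univ.filter (fun Z : Finset Λ => Disjoint Z B), Ψ Z) +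
        ∑ Z ∈ univ.filter (fun Z : Finset Λ => ¬ Disjoint Z B), Ψ Z :=
      (sub_eq_iff_eq_add'.mp (sum_sub_sum_filter_disjoint Ψ B))
    rw [hdec, Matrix.mul_add, Matrix.add_mul, hc.eq]
    abel
  rw [hsplit]
  have h1 : ‖T * (∑ Z ∈ univ.filter (fun Z : Finset Λ => ¬ Disjoint Z B), Ψ Z) -
      (∑ Z ∈ univ.filter (fun Z : Finset Λ => ¬ Disjoint Z B), Ψ Z) * T‖ ≤
      ∑ Z ∈ univ.filter (fun Z : Finset Λ => ¬ Disjoint Z B), ‖T * Ψ Z - Ψ Z * T‖ := by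
    rw [Matrix.mul_sum, Matrix.sum_mul, ← Finset.sum_sub_distrib]
    exact norm_sum_le _ _
  refine h1.trans ?_
  calc ∑ Z ∈ univ.filter (fun Z : Finset Λ => ¬ Disjoint Z B), ‖T * Ψ Z - Ψ Z * T‖
      ≤ ∑ Z ∈ univ.filter (fun Z : Finset Λ => ¬ Disjoint Z B), 2 * ‖T‖ * ‖Ψ Z‖ :=
        sum_le_sum fun Z _ => norm_commutator_le _ _
    _ = 2 * ‖T‖ * ∑ Z ∈ univ.filter (fun Z : Finset Λ => ¬ Disjoint Z B), ‖Ψ Z‖ := by rw [mul_sum]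
    _ ≤ 2 * ‖T‖ * (#B * J₀) :=
        mul_le_mul_of_nonneg_left (sum_norm_filter_not_disjoint_le hJ B) (by positivity)

/-- **R5 (norm): commutator of a centred observable with a quasi-local generator.** Let `A` be
centred at the chain of regions `S 0 ⊆ S 1 ⊆ ⋯ ⊆ S m = Λ` with tails `E`
(`‖A − 𝔼_{(S k)ᶜ}(A)‖ ≤ E k`) and let the interaction `Ψ` have local norm `≤ J₀`. Then
`‖[A, Σ_Z Ψ Z]‖ ≤ 2 J₀ (‖A‖ |S 0| + Σ_{k<m} (E(k+1) + E k) |S (k+1)|)`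
(telescoping `A = 𝔼_{(S 0)ᶜ}A + Σ_k (𝔼_{(S(k+1))ᶜ}A − 𝔼_{(S k)ᶜ}A)` into strictly local shells,
`eq_twirl_add_sum_range_sub`). MZ13 §5.2 (the commutators `[𝓕(Q_u), D_v]` behind `X²_u`).
[folklore] -/
theorem norm_comm_centred_interaction_le {Ψ : Interaction Λ q} (hΨ : Ψ.IsLocal) {J₀ : ℝ}
    (hJ : ∀ y : Λ, ∑ Z ∈ univ.filter (fun Z : Finset Λ => y ∈ Z), ‖Ψ Z‖ ≤ J₀)
    (S : ℕ → Finset Λ) (hS : Monotone S) {m : ℕ} (hm : S m = Finset.univ) (A : Op Λ q) {E : ℕ → ℝ}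
    (hcent : ∀ k, ‖A - twirl (S k)ᶜ A‖ ≤ E k) :
    ‖A * (∑ Z, Ψ Z) - (∑ Z, Ψ Z) * A‖ ≤
      2 * J₀ * (‖A‖ * #(S 0) + ∑ k ∈ range m, (E (k + 1) + E k) * #(S (k + 1))) := by
  have hJ0 : 0 ≤ J₀ ∨ IsEmpty Λ := by
    rcases isEmpty_or_nonempty Λ with h | ⟨⟨y⟩⟩
    · exact Or.inr h
    · exact Or.inl ((sum_nonneg fun _ _ => norm_nonneg _).trans (hJ y))
  set D : Op Λ q := ∑ Z, Ψ Z with hD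
  -- telescoping of `A`
  have htel := eq_twirl_add_sum_range_sub S hm A
  have hcomm_lin : ∀ X Y : Op Λ q, (X + Y) * D - D * (X + Y) = (X * D - D * X) + (Y * D - D * Y) := by
    intro X Y; simp only [Matrix.add_mul, Matrix.mul_add]; abel
  have hcomm_sum : ∀ (s : Finset ℕ) (f : ℕ → Op Λ q),
      (∑ k ∈ s, f k) * D - D * (∑ k ∈ s, f k) = ∑ k ∈ s, (f k * D - D * f k) := by
    intro s f; rw [Finset.sum_mul, Finset.mul_sum, ← Finset.sum_sub_distrib]
  conv_lhs => rw [htel]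
  rw [hcomm_lin, hcomm_sum]
  refine (norm_add_le _ _).trans ?_
  -- the innermost part
  have h0 : ‖twirl (S 0)ᶜ A * D - D * twirl (S 0)ᶜ A‖ ≤ 2 * ‖A‖ * (#(S 0) * J₀) := by
    refine (norm_comm_local_interaction_le hΨ hJ (isSupportedOn_twirl_compl (S 0) A)).trans ?_
    rcases hJ0 with hJ0 | hΛ
    · exact mul_le_mul_of_nonneg_right (mul_le_mul_of_nonneg_left (norm_twirl_le _ _) zero_le_two)
        (mul_nonneg (Nat.cast_nonneg _) hJ0)
    · have : #(S 0) = 0 := by rw [Finset.card_eq_zero]; exact Finset.eq_empty_of_isEmpty _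
      simp [this]
  -- the shells
  have hk : ∀ k ∈ range m, ‖(twirl (S (k + 1))ᶜ A - twirl (S k)ᶜ A) * D -
      D * (twirl (S (k + 1))ᶜ A - twirl (S k)ᶜ A)‖ ≤ 2 * (E (k + 1) + E k) * (#(S (k + 1)) * J₀) := by
    intro k _
    refine (norm_comm_local_interaction_le hΨ hJ
      (isSupportedOn_twirl_compl_sub (hS (Nat.le_succ k)) A)).trans ?_
    have hn : ‖twirl (S (k + 1))ᶜ A - twirl (S k)ᶜ A‖ ≤ E (k + 1) + E k :=
      (norm_twirl_sub_twirl_le _ _ A).trans (add_le_add (hcent _) (hcent _))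
    rcases hJ0 with hJ0 | hΛ
    · exact mul_le_mul_of_nonneg_right (mul_le_mul_of_nonneg_left hn zero_le_two)
        (mul_nonneg (Nat.cast_nonneg _) hJ0)
    · have : #(S (k + 1)) = 0 := by rw [Finset.card_eq_zero]; exact Finset.eq_empty_of_isEmpty _
      simp [this]
  calc ‖twirl (S 0)ᶜ A * D - D * twirl (S 0)ᶜ A‖ +
        ‖∑ k ∈ range m, ((twirl (S (k + 1))ᶜ A - twirl (S k)ᶜ A) * D -
          D * (twirl (S (k + 1))ᶜ A - twirl (S k)ᶜ A))‖
      ≤ 2 * ‖A‖ * (#(S 0) * J₀) + ∑ k ∈ range m, 2 * (E (k + 1) + E k) * (#(S (k + 1)) * J₀) :=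
        add_le_add h0 ((norm_sum_le _ _).trans (sum_le_sum hk))
    _ = 2 * J₀ * (‖A‖ * #(S 0) + ∑ k ∈ range m, (E (k + 1) + E k) * #(S (k + 1))) := by
        rw [mul_add, mul_sum]
        congr 1
        · ring
        · exact sum_congr rfl fun k _ => by ring

/-- Telescoping from an intermediate scale: `A − 𝔼_{(S m)ᶜ}A = Σ_{m ≤ k < M} (𝔼_{(S(k+1))ᶜ}A − 𝔼_{(S k)ᶜ}A)`
for `S M = Λ`, `m ≤ M`. [folklore] -/
theorem sub_twirl_eq_sum_Ico (S : ℕ → Finset Λ) {m M : ℕ} (hmM : m ≤ M) (hM : S M = Finset.univ)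
    (A : Op Λ q) :
    A - twirl (S m)ᶜ A = ∑ k ∈ Finset.Ico m M, (twirl (S (k + 1))ᶜ A - twirl (S k)ᶜ A) := by
  have h := Finset.sum_range_sub (fun i => twirl (S (m + i))ᶜ A) (M - m)
  simp only [Nat.add_zero, Nat.add_sub_cancel' hmM, hM, Finset.compl_univ, twirl_empty] at h
  rw [Finset.sum_Ico_eq_sum_range]
  exact ((Finset.sum_congr rfl fun _ _ => rfl).trans h).symm

/-- **R5 (tails): the commutator of a centred observable with a quasi-local generator is
centred.** With `A` centred along the chain `S` (tails `E`, `S M = Λ`), `Ψ` of local norm `≤ J₀`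
whose terms violating the short-range predicate `R` have local norm `≤ K`, and a region `T`
containing every short-range term that meets `S m`:
`‖[A, Σ Ψ] − 𝔼_{Tᶜ}([A, Σ Ψ])‖ ≤ 2 (2J₀ Σ_{m ≤ k < M} (E(k+1) + E k)|S(k+1)| + 2‖A‖ |S m| K)`
(the local approximant `[𝔼_{(S m)ᶜ}A, Σ_{R Z, Z ∩ S m ≠ ∅} Ψ Z] ∈ 𝔄_T`). MZ13 §5.2 (the
decompositions of the commutators with `D(s)` into terms "supported on larger and larger sets,
with decreasing norm", p. 11). [folklore] -/
theorem norm_comm_centred_sub_twirl_le {Ψ : Interaction Λ q} (hΨ : Ψ.IsLocal) {J₀ : ℝ}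
    (hJ : ∀ y : Λ, ∑ Z ∈ univ.filter (fun Z : Finset Λ => y ∈ Z), ‖Ψ Z‖ ≤ J₀)
    {R : Finset Λ → Prop} [DecidablePred R] {K : ℝ}
    (hK : ∀ y : Λ, ∑ Z ∈ univ.filter (fun Z : Finset Λ => y ∈ Z), ‖(if R Z then (0 : Op Λ q) else Ψ Z)‖ ≤ K)
    (S : ℕ → Finset Λ) (hS : Monotone S) {m M : ℕ} (hmM : m ≤ M) (hM : S M = Finset.univ)
    {T : Finset Λ} (hT : S m ⊆ T) (hRT : ∀ Z, R Z → ¬ Disjoint Z (S m) → Z ⊆ T)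
    (A : Op Λ q) {E : ℕ → ℝ} (hcent : ∀ k, ‖A - twirl (S k)ᶜ A‖ ≤ E k) :
    ‖(A * (∑ Z, Ψ Z) - (∑ Z, Ψ Z) * A) - twirl Tᶜ (A * (∑ Z, Ψ Z) - (∑ Z, Ψ Z) * A)‖ ≤
      2 * (2 * J₀ * ∑ k ∈ Finset.Ico m M, (E (k + 1) + E k) * #(S (k + 1)) + 2 * ‖A‖ * (#(S m) * K)) := by
  have hJ0 : 0 ≤ J₀ ∨ IsEmpty Λ := by
    rcases isEmpty_or_nonempty Λ with h | ⟨⟨y⟩⟩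
    · exact Or.inr h
    · exact Or.inl ((sum_nonneg fun _ _ => norm_nonneg _).trans (hJ y))
  set D : Op Λ q := ∑ Z, Ψ Z with hD
  set Am : Op Λ q := twirl (S m)ᶜ A with hAm
  set Din : Op Λ q := ∑ Z ∈ univ.filter (fun Z : Finset Λ => R Z ∧ ¬ Disjoint Z (S m)), Ψ Z with hDin
  set Yloc : Op Λ q := Am * Din - Din * Am with hYloc
  have hAm_supp : IsSupportedOn Am (S m) := isSupportedOn_twirl_compl _ A
  have hAm_norm : ‖Am‖ ≤ ‖A‖ := norm_twirl_le _ A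
  -- the local approximant is supported in `T`
  have hDin_supp : IsSupportedOn Din T := by
    refine IsSupportedOn.sum _ fun Z hZ => ?_
    simp only [mem_filter, Finset.mem_univ, true_and] at hZ
    exact IsSupportedOn.mono_holds (hΨ.isSupportedOn Z) (hRT Z hZ.1 hZ.2)
  have hYloc_supp : IsSupportedOn Yloc T := by
    have hAmT : IsSupportedOn Am T := IsSupportedOn.mono_holds hAm_supp hT
    have h1 := IsSupportedOn.mul_holds hAmT hDin_supp
    have h2 := IsSupportedOn.mul_holds hDin_supp hAmT
    have h3 := h1.add (h2.smul (-1))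
    simpa [hYloc, sub_eq_add_neg] using h3
  -- general principle: `‖Y − 𝔼 Y‖ ≤ 2‖Y − Yloc‖` for a local `Yloc`
  have hprinciple : ∀ Y : Op Λ q, ‖Y - twirl Tᶜ Y‖ ≤ 2 * ‖Y - Yloc‖ := by
    intro Y
    have hfix : twirl Tᶜ Yloc = Yloc := twirl_eq_self_of_isSupportedOn Tᶜ (by rw [compl_compl]; exact hYloc_supp)
    calc ‖Y - twirl Tᶜ Y‖ = ‖(Y - Yloc) - twirl Tᶜ (Y - Yloc)‖ := by rw [twirl_sub, hfix]; abel_nf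
      _ ≤ ‖Y - Yloc‖ + ‖twirl Tᶜ (Y - Yloc)‖ := norm_sub_le _ _
      _ ≤ ‖Y - Yloc‖ + ‖Y - Yloc‖ := add_le_add le_rfl (norm_twirl_le _ _)
      _ = 2 * ‖Y - Yloc‖ := by ring
  refine (hprinciple _).trans (mul_le_mul_of_nonneg_left ?_ zero_le_two)
  -- `[A, D] − Yloc = [A − Am, D] + ([Am, D] − Yloc)`
  have hsplit : (A * D - D * A) - Yloc = ((A - Am) * D - D * (A - Am)) + ((Am * D - D * Am) - Yloc) := by
    simp only [hYloc, Matrix.sub_mul, Matrix.mul_sub]; abel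
  rw [hsplit]
  refine (norm_add_le _ _).trans (add_le_add ?_ ?_)
  · -- the far shells of `A`
    rw [sub_twirl_eq_sum_Ico S hmM hM A, Finset.sum_mul, Finset.mul_sum, ← Finset.sum_sub_distrib]
    refine (norm_sum_le _ _).trans ?_
    have hk : ∀ k ∈ Finset.Ico m M, ‖(twirl (S (k + 1))ᶜ A - twirl (S k)ᶜ A) * D -
        D * (twirl (S (k + 1))ᶜ A - twirl (S k)ᶜ A)‖ ≤ 2 * (E (k + 1) + E k) * (#(S (k + 1)) * J₀) := by
      intro k _
      refine (norm_comm_local_interaction_le hΨ hJ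
        (isSupportedOn_twirl_compl_sub (hS (Nat.le_succ k)) A)).trans ?_
      have hn : ‖twirl (S (k + 1))ᶜ A - twirl (S k)ᶜ A‖ ≤ E (k + 1) + E k :=
        (norm_twirl_sub_twirl_le _ _ A).trans (add_le_add (hcent _) (hcent _))
      rcases hJ0 with hJ0 | hΛ
      · exact mul_le_mul_of_nonneg_right (mul_le_mul_of_nonneg_left hn zero_le_two)
          (mul_nonneg (Nat.cast_nonneg _) hJ0)
      · have : #(S (k + 1)) = 0 := by rw [Finset.card_eq_zero]; exact Finset.eq_empty_of_isEmpty _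
        simp [this]
    refine (sum_le_sum hk).trans (le_of_eq ?_)
    rw [mul_sum]
    exact sum_congr rfl fun k _ => by ring
  · -- `[Am, D] − Yloc = [Am, Σ_{¬(R ∧ meets)} Ψ]`, and the `R`-terms not meeting `S m` commute with `Am`
    have hrest : (Am * D - D * Am) - Yloc =
        Am * (∑ Z ∈ univ.filter (fun Z : Finset Λ => ¬ (R Z ∧ ¬ Disjoint Z (S m))), Ψ Z) -
          (∑ Z ∈ univ.filter (fun Z : Finset Λ => ¬ (R Z ∧ ¬ Disjoint Z (S m))), Ψ Z) * Am := by
      have hdec : D = Din + ∑ Z ∈ univ.filter (fun Z : Finset Λ => ¬ (R Z ∧ ¬ Disjoint Z (S m))), Ψ Z := by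
        rw [hD, hDin, sum_filter_add_sum_filter_not]
      rw [hYloc, hdec, Matrix.mul_add, Matrix.add_mul]
      abel
    rw [hrest]
    -- split the remaining terms into the long-range ones and the short-range ones away from `S m`
    set Ψ' : Interaction Λ q := fun Z => if R Z then 0 else Ψ Z with hΨ'
    have hΨ'loc : Ψ'.IsLocal := fun Z => by
      by_cases h : R Z
      · simp only [hΨ', if_pos h]; exact ⟨IsSupportedOn.zero Z, isHermitian_zero⟩
      · simp only [hΨ', if_neg h]; exact hΨ Z
    have hsum : (∑ Z ∈ univ.filter (fun Z : Finset Λ => ¬ (R Z ∧ ¬ Disjoint Z (S m))), Ψ Z) =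
        (∑ Z, Ψ' Z) + ∑ Z ∈ univ.filter (fun Z : Finset Λ => R Z ∧ Disjoint Z (S m)), Ψ Z := by
      have h1 : (∑ Z, Ψ' Z) = ∑ Z ∈ univ.filter (fun Z : Finset Λ => ¬ R Z), Ψ Z := by
        rw [sum_filter]
        refine sum_congr rfl fun Z _ => ?_
        by_cases h : R Z
        · simp only [hΨ', if_pos h, if_neg (not_not.mpr h)]
        · simp only [hΨ', if_neg h, if_pos h]
      rw [h1, ← sum_union]
      · refine sum_congr ?_ fun _ _ => rfl
        ext Z
        simp only [mem_filter, Finset.mem_univ, true_and, Finset.mem_union]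
        tauto
      · rw [Finset.disjoint_left]
        intro Z h1 h2
        simp only [mem_filter, Finset.mem_univ, true_and] at h1 h2
        exact h1 h2.1
    have hcomm2 : Commute (∑ Z ∈ univ.filter (fun Z : Finset Λ => R Z ∧ Disjoint Z (S m)), Ψ Z) Am := by
      refine Commute.sum_left _ _ _ fun Z hZ => ?_
      simp only [mem_filter, Finset.mem_univ, true_and] at hZ
      exact commute_of_disjoint_holds (hΨ.isSupportedOn Z) hAm_supp hZ.2
    rw [hsum, Matrix.mul_add, Matrix.add_mul, hcomm2.eq]
    have : Am * (∑ Z, Ψ' Z) + Am * (∑ Z ∈ univ.filter (fun Z : Finset Λ => R Z ∧ Disjoint Z (S m)), Ψ Z) -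
        ((∑ Z, Ψ' Z) * Am + Am * ∑ Z ∈ univ.filter (fun Z : Finset Λ => R Z ∧ Disjoint Z (S m)), Ψ Z) =
        Am * (∑ Z, Ψ' Z) - (∑ Z, Ψ' Z) * Am := by abel
    rw [this]
    refine (norm_comm_local_interaction_le hΨ'loc hK hAm_supp).trans ?_
    rcases isEmpty_or_nonempty Λ with hΛ | ⟨⟨y⟩⟩
    · have : #(S m) = 0 := by rw [Finset.card_eq_zero]; exact Finset.eq_empty_of_isEmpty _
      simp [this]
    · have hK0 : 0 ≤ K := (sum_nonneg fun _ _ => norm_nonneg _).trans (hK y)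
      exact mul_le_mul_of_nonneg_right (mul_le_mul_of_nonneg_left hAm_norm zero_le_two)
        (mul_nonneg (Nat.cast_nonneg _) hK0)

end CommutatorCentred

end Literature.MathematicalPhysics.QuantumLattice
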